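import Mathlib
import Literature.MathematicalPhysics.QuantumFieldTheory.Balaban1983to89.B5Block118
import Literature.MathematicalPhysics.QuantumFieldTheory.BalabanImbrieJaffe1984to88.BIJ85Eq712SymbolCalculus

/-!
# `BalabanImbrieJaffe1984to88.BIJ85Eq7111CrossSymbols` — T. Bałaban, J. Imbrie, A. Jaffe, *Renormalization of the Higgs
model: minimizers, propagators and the stability of mean field theory*, Commun. Math. Phys. **97** (1985) 299–329
[BalabanImbrieJaffe1985]: Sect. 7.1 p. 322 — **the momentum representation of the averaging operators BETWEEN the η-lattice
and the unit lattice** (the SHAPE of (7.1.11) *"(Q^e_k f)~_{μν}(p′) = Σ_l u(p′+l) f̃_{μν}(p′+l)(v_μ(p′+l)v_ν(p′+l))^{−1}"* and of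
[6I] (1.61)): an operator from η-lattice fields to unit-lattice fields commuting with the UNIT-LATTICE translations is, in
the Fourier representation, a family of rectangular matrices `σ_T(p′+l)` COUPLING THE COSET `p = p′ + l` of a unit momentum
`p′` to `p′` — `(Tf)~(p′) = c·Σ_l σ_T(p′+l) f̃(p′+l)` — together with the product rules by which (7.1.12)
`σ_k = Q^e_k(I − ∂G∂^*)Q^{e*}_k` becomes the fibrewise *"averaging operators … sandwiched"* sums `Σ_l σ_Q(p′+l)[…](p′+l)σ_Q(p′+l)^*`
of (7.1.14)–(7.1.16) — PROVED for all such operators on the finite tori; file 11 of the (7.1.2) cluster (square/rectangular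
unit-torus calculus `BIJ85Eq712Plancherel`/`BIJ85Eq712SymbolCalculus`, η-torus `BIJ85Eq714FineTorus`,
`BIJ85Eq719BlockAverageSymbols`); the CONCRETE Q^e_k of (2.21)/(7.1.11) is the sibling `BIJ85Eq7111EdgeAverage`

statement-level skeleton of published theorems with citation tags; proofs where landed; nothing here is a claim about
the Yang–Mills mass gap

PDF held: `paper:balaban1985-cmp97-bij-higgs-minimizers` (journal page = PDF page + 298).  Text read: PDF p. 24 (journal 322)
as image (`run/shared/lean/pub/pub-balaban/b2b-balaban-beta-lit3-g8/pages/1985-cmp97-bij-higgs-minimizers-p024-x2.png`).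

CITATION HEADER (lean-in-tree rule).  Part of the lit-balaban TYPED SKELETON (HOME `run/shared/lean/pub/lit-balaban/`); WHAT IS
REPRODUCED: the structural content of displays **(7.1.10)–(7.1.12)** of SKELETON row **C1.Eq7.1.2-7.1.12** (p. 322 [PDF 24],
verbatim: *"φ_μ(p′) = Σ_{l∈2πℤ^d, |l_i|≤π/η} |u(p′+l)v_μ(p′+l)|²Δ(p′+l)^{−1}. (7.1.10) In terms of these functions we can express the
averaging operators Q^e_k, etc. For example (Q^e_k f)~_{μν}(p′) = Σ_l u(p′+l) f̃_{μν}(p′+l)(v_μ(p′+l)v_ν(p′+l))^{−1}. (7.1.11) The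
basic object we wish to study is σ_k, defined in (4.2.2), σ_k = Q^e_k(I − ∂G_{k,Ax}∂^*)Q^{e*}_k. (7.1.12)"*) and of the sentence
p. 323 [PDF 25] *"Thus σ_k has the general form of a sum of projection operators, or tensor products of projection operators,
sandwiched between averaging operators"*, `HOME/lit-balaban-r15/ROWS-C1.md` (owner r15, referee ref-5).
TYPED READING.  As in `BIJ85Eq712Plancherel` (unit torus `Tor M` of `Balaban1983to89.B5Prop11Plancherel`, multi-component
fields `Tor M × m → ℂ`, `F⊗1 = dftC`) and `BIJ85Eq714FineTorus`/pub-balaban `B5Block118` (η-torus `Tor (fine n M)`, `n = η^{−1}`,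
the unit lattice embedded by `up : y ↦ n·y`, fine dual momenta `p = p′ + l ↔ pOf n M (k, q)`, a bijection `pOf_bijective`): an
averaging operator is a matrix `T : Matrix (Tor M × m) (Tor (fine n M) × m′) ℂ`; *"σ_k is translation invariant"* for such a
cross-lattice operator means invariance under the unit-lattice translations, `T (y+a, i) (x+n·a, j) = T (y,i) (x,j)`
(`IsCrossTI`); its SYMBOL at the fine momentum `p` is the `m × m′` matrix `σ_T(p)_{ij} = Σ_z T((0,i),(z,j)) e^{ip·z}` (`symbX`);
the printed `Σ_l` over `l ∈ 2πℤ^d, |l_i| ≤ π/η` is the finite sum over the `n^d` offsets `k : Fin d → Fin n` of the coset of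
`q ↔ p′`; the constant `c = cQ n M = (√(n^d))^{−1}` is the ratio of the unitary normalisations of the two DFTs (`B5Block118.cQ_eq`;
`= 1` in the paper's weighted conventions (1.29)/(2.20)).
WHAT IS KERNEL-CHECKED (zero `sorry`, standard axioms): `IsCrossTI.apply_eq` (convolution form); the coset coordinates `kqOf`,
`coarse` (`coarse (p′+l) = p′`); the cross fibre operator `crossFibre` and **`dftC_mul_mul_star_cross`**:
`(F₁⊗1) T (F_η⊗1)^* = crossFibre (c·σ_T)` — entrywise `((F₁⊗1)T(F_η⊗1)^*)((q,i),(p′+l,j)) = δ_{q,p′}·c·σ_T(p′+l)_{ij}`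
(`dftC_mul_mul_star_apply`); **`dftC_mulVec_cross`**: `(Tf)^(p′)_i = c·Σ_l Σ_j σ_T(p′+l)_{ij} f̂_j(p′+l)` — THE SHAPE OF (7.1.11);
closure of the class under unit-TI ∘ cross, cross ∘ fine-TI, sums, scalars, and `cross ∘ cross^*` = unit-TI
(`IsCrossTI.mul_left/mul_right/mul_conjTranspose`); the symbol rules **`symbX_mul_left`** (`σ_{BT}(p′+l) = σ_B(p′)σ_T(p′+l)`),
**`symbX_mul_right`** (`σ_{TA}(p) = σ_T(p)σ_A(p)`), **`symb_mul_conjTranspose`** (`σ_{TS^*}(p′) = c²Σ_l σ_T(p′+l)σ_S(p′+l)^*`) and the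
SANDWICH **`symb_sandwich`**: for a fine translation-invariant `R`, `σ_{TRS^*}(p′) = c²Σ_l σ_T(p′+l)σ_R(p′+l)σ_S(p′+l)^*` — the
form of (7.1.14) *"each term on the right side is evaluated at momentum p′ + l"*.  NOT CLAIMED here: the symbols of the CONCRETE
Q^e_k (sibling `BIJ85Eq7111EdgeAverage`), of G_{k,Ax}/G_k ([6I] (1.83)–(1.84): invariant under unit translations only, so its
momentum representation couples different `l` — the τ₂ structure (7.1.15)), and the identification (7.1.13).
Unit `lit-balaban-p27` (gen 5), HOME as above.
-/

namespace Literature.MathematicalPhysics.QuantumFieldTheory.BalabanImbrieJaffe1984to88.BIJ85Eq7111CrossSymbols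

open scoped BigOperators Matrix ComplexConjugate
open Finset Complex
open Literature.MathematicalPhysics.QuantumFieldTheory.Balaban1983to89
open Literature.MathematicalPhysics.QuantumFieldTheory.Balaban1983to89.B5Prop11Plancherel
open Literature.MathematicalPhysics.QuantumFieldTheory.Balaban1983to89.B5Block118
open Literature.MathematicalPhysics.QuantumFieldTheory.BalabanImbrieJaffe1984to88.BIJ85Eq712Plancherel
open Literature.MathematicalPhysics.QuantumFieldTheory.BalabanImbrieJaffe1984to88.BIJ85Eq712SymbolCalculus

noncomputable section

variable {d : ℕ} (n : ℕ) [NeZero n] (M : Fin d → ℕ) [hM : ∀ μ, NeZero (M μ)]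
variable (m m' m'' : Type*) [Fintype m] [DecidableEq m] [Fintype m'] [DecidableEq m'] [Fintype m''] [DecidableEq m'']

/-! ## §1 The coset coordinates `p = p′ + l` of a fine momentum -/

/-- The coset coordinates `(k, q) ↔ (l, p′)` of a fine dual momentum `p = p′ + l` (inverse of pub-balaban's bijection
`B5Block118.pOf`; *"p′ = p mod 2π, (7.1.8) so p′ denotes a unit lattice momentum"*). [cite: BalabanImbrieJaffe1985, (7.1.8) p.322] -/
def kqOf : Tor (fine n M) ≃ (Fin d → Fin n) × Tor M :=
  (Equiv.ofBijective (pOf n M) (pOf_bijective n M)).symm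

/-- `kqOf (p′ + l) = (l, p′)`. [cite: BalabanImbrieJaffe1985, (7.1.8) p.322] -/
@[simp] theorem kqOf_pOf (kq : (Fin d → Fin n) × Tor M) : kqOf n M (pOf n M kq) = kq :=
  (Equiv.ofBijective (pOf n M) (pOf_bijective n M)).symm_apply_apply kq

/-- `p = p′ + l` recovered from its coordinates. [cite: BalabanImbrieJaffe1985, (7.1.8) p.322] -/
@[simp] theorem pOf_kqOf (p : Tor (fine n M)) : pOf n M (kqOf n M p) = p :=
  (Equiv.ofBijective (pOf n M) (pOf_bijective n M)).apply_symm_apply p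

/-- **(7.1.8)** `p′ = p mod 2π`: the unit-lattice momentum under the fine momentum `p`. [cite: BalabanImbrieJaffe1985, (7.1.8) p.322] -/
def coarse (p : Tor (fine n M)) : Tor M := (kqOf n M p).2

/-- `(p′ + l) mod 2π = p′`. [cite: BalabanImbrieJaffe1985, (7.1.8) p.322] -/
@[simp] theorem coarse_pOf (k : Fin d → Fin n) (q : Tor M) : coarse n M (pOf n M (k, q)) = q := by
  rw [coarse, kqOf_pOf]

/-! ## §2 Cross-lattice operators commuting with the unit-lattice translations; their symbols -/

/-- An averaging-type operator from η-lattice fields (components `m′`) to unit-lattice fields (components `m`) is TRANSLATION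
INVARIANT when it commutes with the unit-lattice translations, the unit lattice sitting in the η-lattice by `y ↦ n·y`
(`B5Block118.up`): `T (y+a, i) (x+n·a, j) = T (y,i) (x,j)` (*"Since we study periodic boundary conditions, σ_k is translation
invariant"*, p. 321, for the factors Q^e_k, Q^{e*}_k of (7.1.12)). [cite: BalabanImbrieJaffe1985, (7.1.11) p.322] -/
def IsCrossTI (T : Matrix (Tor M × m) (Tor (fine n M) × m') ℂ) : Prop :=
  ∀ (a y : Tor M) (x : Tor (fine n M)) (i : m) (j : m'), T (y + a, i) (x + up n M a, j) = T (y, i) (x, j)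

omit [NeZero n] hM in
/-- `up (−y) = −up y`. [cite: Balaban1984PropagatorsI, (1.18) p.20] -/
theorem up_neg (y : Tor M) : up n M (-y) = -up n M y := by
  funext ν
  show upHom n M ν ((-y) ν) = -(upHom n M ν (y ν))
  rw [Pi.neg_apply, map_neg]

variable {n M m m'}

omit [NeZero n] hM [Fintype m] [DecidableEq m] [Fintype m'] [DecidableEq m'] in
/-- A translation-invariant cross-lattice operator is a convolution: `T((y,i),(x,j)) = T((0,i),(x − n·y, j))`.
[cite: BalabanImbrieJaffe1985, (7.1.11) p.322] -/
theorem IsCrossTI.apply_eq {T : Matrix (Tor M × m) (Tor (fine n M) × m') ℂ} (hT : IsCrossTI n M m m' T) (y : Tor M)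
    (x : Tor (fine n M)) (i : m) (j : m') : T (y, i) (x, j) = T (0, i) (x - up n M y, j) := by
  have h := hT (-y) y x i j
  rw [add_neg_cancel, up_neg, ← sub_eq_add_neg] at h
  exact h.symm

variable (n M m m')

/-- The SYMBOL of a cross-lattice operator at the fine momentum `p = p′ + l`: the `m × m′` matrix
`σ_T(p)_{ij} = Σ_z T((0,i),(z,j)) e^{ip·z}` — the *"u(p′+l)(v_μ(p′+l)v_ν(p′+l))^{−1}"* slot of (7.1.11).
[cite: BalabanImbrieJaffe1985, (7.1.11) p.322] -/
def symbX (T : Matrix (Tor M × m) (Tor (fine n M) × m') ℂ) (p : Tor (fine n M)) : Matrix m m' ℂ :=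
  Matrix.of fun i j => ∑ z : Tor (fine n M), T (0, i) (z, j) * chi (fine n M) p z

omit [Fintype m] [DecidableEq m] [Fintype m'] [DecidableEq m'] in
/-- entries of the cross symbol (API). [cite: BalabanImbrieJaffe1985, (7.1.11) p.322] -/
theorem symbX_apply (T : Matrix (Tor M × m) (Tor (fine n M) × m') ℂ) (p : Tor (fine n M)) (i : m) (j : m') :
    symbX n M m m' T p i j = ∑ z : Tor (fine n M), T (0, i) (z, j) * chi (fine n M) p z := rfl

/-- The cross "multiplication operator" with symbol family `S`: it couples the unit momentum `p′` exactly to the fine momenta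
`p′ + l` above it, `(crossFibre S)((q,i),(p,j)) = δ_{q, p mod 2π} S(p)_{ij}` (the `Σ_l` of (7.1.11)).
[cite: BalabanImbrieJaffe1985, (7.1.11) p.322] -/
def crossFibre (S : Tor (fine n M) → Matrix m m' ℂ) : Matrix (Tor M × m) (Tor (fine n M) × m') ℂ :=
  Matrix.of fun a b => if a.1 = coarse n M b.1 then S b.1 a.2 b.2 else 0

omit [Fintype m] [DecidableEq m] [Fintype m'] [DecidableEq m'] in
/-- entries of the cross fibre operator (API). [cite: BalabanImbrieJaffe1985, (7.1.11) p.322] -/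
theorem crossFibre_apply (S : Tor (fine n M) → Matrix m m' ℂ) (q : Tor M) (i : m) (p : Tor (fine n M)) (j : m') :
    crossFibre n M m m' S (q, i) (p, j) = if q = coarse n M p then S p i j else 0 := rfl

omit [Fintype m] [DecidableEq m] [Fintype m'] [DecidableEq m'] in
/-- entries of the cross fibre operator at `p = p′ + l` (API). [cite: BalabanImbrieJaffe1985, (7.1.11) p.322] -/
theorem crossFibre_apply_pOf (S : Tor (fine n M) → Matrix m m' ℂ) (q : Tor M) (i : m) (k : Fin d → Fin n) (q' : Tor M)
    (j : m') : crossFibre n M m m' S (q, i) (pOf n M (k, q'), j) = if q = q' then S (pOf n M (k, q')) i j else 0 := by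
  rw [crossFibre_apply, coarse_pOf]

omit [Fintype m] [DecidableEq m] [Fintype m'] [DecidableEq m'] in
/-- A cross fibre operator determines its symbol family. [cite: BalabanImbrieJaffe1985, (7.1.11) p.322] -/
theorem crossFibre_inj {S S' : Tor (fine n M) → Matrix m m' ℂ} (h : crossFibre n M m m' S = crossFibre n M m m' S') :
    S = S' := by
  funext p
  ext i j
  have h1 := congrFun (congrFun h (coarse n M p, i)) (p, j)
  rwa [crossFibre_apply, crossFibre_apply, if_pos rfl, if_pos rfl] at h1

/-! ## §3 The momentum representation `(F₁⊗1) T (F_η⊗1)^* = crossFibre (c·σ_T)` -/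

omit [NeZero n] [Fintype m'] [DecidableEq m'] in
/-- kernel: `((F₁⊗1) T)((q,i), b) = Σ_y F¹_{q,y} T((y,i), b)`. [folklore] -/
private theorem dftC_mul_apply (T : Matrix (Tor M × m) (Tor (fine n M) × m') ℂ) (q : Tor M) (i : m)
    (b : Tor (fine n M) × m') : (dftC M m * T) (q, i) b = ∑ y : Tor M, dft M q y * T (y, i) b := by
  rw [Matrix.mul_apply, Fintype.sum_prod_type]
  refine Finset.sum_congr rfl fun y _ => ?_
  rw [Finset.sum_eq_single i]
  · rw [dftC_apply, if_pos rfl]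
  · intro j _ hj
    rw [dftC_apply, if_neg (Ne.symm hj), zero_mul]
  · exact fun h => absurd (Finset.mem_univ i) h

/-- kernel: `((F₁⊗1) T (F_η⊗1)^*)((q,i),(p,j)) = Σ_y Σ_x F¹_{q,y} T((y,i),(x,j)) conj F^η_{p,x}`. [folklore] -/
private theorem cross_apply_sum (T : Matrix (Tor M × m) (Tor (fine n M) × m') ℂ) (q : Tor M) (i : m)
    (p : Tor (fine n M)) (j : m') :
    (dftC M m * T * star (dftC (fine n M) m')) (q, i) (p, j)
      = ∑ y : Tor M, ∑ x : Tor (fine n M), dft M q y * T (y, i) (x, j) * conj (dft (fine n M) p x) := by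
  rw [Matrix.mul_apply, Fintype.sum_prod_type]
  have h1 : ∀ x : Tor (fine n M), ∑ j' : m', (dftC M m * T) (q, i) (x, j') * (star (dftC (fine n M) m')) (x, j') (p, j)
      = (dftC M m * T) (q, i) (x, j) * conj (dft (fine n M) p x) := by
    intro x
    rw [Finset.sum_eq_single j]
    · rw [Matrix.star_apply, dftC_apply, if_pos rfl, Complex.star_def]
    · intro j' _ hj'
      rw [Matrix.star_apply, dftC_apply, if_neg (Ne.symm hj'), star_zero, mul_zero]
    · exact fun h => absurd (Finset.mem_univ j) h
  simp_rw [h1, dftC_mul_apply, Finset.sum_mul]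
  rw [Finset.sum_comm]

/-- **The momentum representation of a translation-invariant cross-lattice operator, entrywise**: `(F₁⊗1) T (F_η⊗1)^*` has the
entry `δ_{q,p′}·c·σ_T(p′+l)_{ij}` at `((q,i),(p′+l,j))` — a unit momentum `p′` is coupled exactly to the `n^d` fine momenta
`p′ + l` above it (the `Σ_l` of (7.1.11); `c = cQ n M = (√(n^d))^{−1}`). [cite: BalabanImbrieJaffe1985, (7.1.11) p.322] -/
theorem dftC_mul_mul_star_apply {T : Matrix (Tor M × m) (Tor (fine n M) × m') ℂ} (hT : IsCrossTI n M m m' T) (q : Tor M)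
    (i : m) (k : Fin d → Fin n) (q' : Tor M) (j : m') :
    (dftC M m * T * star (dftC (fine n M) m')) (q, i) (pOf n M (k, q'), j)
      = if q = q' then (cQ n M : ℂ) * symbX n M m m' T (pOf n M (k, q')) i j else 0 := by
  rw [cross_apply_sum]
  -- substitute x = z + n·y in the inner sum and use translation invariance
  have h1 : ∀ y : Tor M, ∑ x : Tor (fine n M), dft M q y * T (y, i) (x, j) * conj (dft (fine n M) (pOf n M (k, q')) x)
      = (cT (fine n M) : ℂ) * (dft M q y * chi M q' y)
          * ∑ z : Tor (fine n M), T (0, i) (z, j) * chi (fine n M) (pOf n M (k, q')) z := by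
    intro y
    rw [Finset.mul_sum]
    refine (Fintype.sum_equiv (Equiv.addRight (up n M y)) _ _ fun z => ?_).symm
    show (cT (fine n M) : ℂ) * (dft M q y * chi M q' y) * (T (0, i) (z, j) * chi (fine n M) (pOf n M (k, q')) z)
      = dft M q y * T (y, i) (z + up n M y, j) * conj (dft (fine n M) (pOf n M (k, q')) (z + up n M y))
    rw [hT.apply_eq y (z + up n M y) i j, add_sub_cancel_right, conj_dft, chi_add_right, chi_pOf_up]
    ring
  simp_rw [h1]
  rw [← Finset.sum_mul, ← Finset.mul_sum]
  have h2 : ∑ y : Tor M, dft M q y * chi M q' y = (cT M : ℂ) * (if q' = q then (Fintype.card (Tor M) : ℂ) else 0) := by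
    rw [← sum_conj_chi_mul_chi, Finset.mul_sum]
    refine Finset.sum_congr rfl fun y _ => ?_
    rw [dft_apply', mul_assoc]
  rw [h2]
  by_cases hq : q = q'
  · subst hq
    rw [if_pos rfl, if_pos rfl, symbX_apply, cQ]
    push_cast
    ring
  · rw [if_neg (fun h => hq h.symm), if_neg hq, mul_zero, mul_zero, zero_mul]

/-- **The momentum representation** as a matrix identity: `(F₁⊗1) T (F_η⊗1)^* = crossFibre (c·σ_T)`.
[cite: BalabanImbrieJaffe1985, (7.1.11) p.322] -/
theorem dftC_mul_mul_star_cross {T : Matrix (Tor M × m) (Tor (fine n M) × m') ℂ} (hT : IsCrossTI n M m m' T) :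
    dftC M m * T * star (dftC (fine n M) m') = crossFibre n M m m' (fun p => (cQ n M : ℂ) • symbX n M m m' T p) := by
  ext ⟨q, i⟩ ⟨p, j⟩
  obtain ⟨⟨k, q'⟩, rfl⟩ := (pOf_bijective n M).2 p
  rw [dftC_mul_mul_star_apply n M m m' hT, crossFibre_apply_pOf, Matrix.smul_apply, smul_eq_mul]

/-- The same, solved for `T`: `T = (F₁⊗1)^* crossFibre (c·σ_T) (F_η⊗1)`. [cite: BalabanImbrieJaffe1985, (7.1.11) p.322] -/
theorem eq_star_dftC_mul_crossFibre_mul_dftC {T : Matrix (Tor M × m) (Tor (fine n M) × m') ℂ} (hT : IsCrossTI n M m m' T) :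
    T = star (dftC M m) * crossFibre n M m m' (fun p => (cQ n M : ℂ) • symbX n M m m' T p) * dftC (fine n M) m' := by
  rw [← dftC_mul_mul_star_cross n M m m' hT]
  calc T = (star (dftC M m) * dftC M m) * T * (star (dftC (fine n M) m') * dftC (fine n M) m') := by
          rw [star_dftC_mul, star_dftC_mul, Matrix.one_mul, Matrix.mul_one]
    _ = star (dftC M m) * (dftC M m * T * star (dftC (fine n M) m')) * dftC (fine n M) m' := by
          simp only [Matrix.mul_assoc]

/-- **THE SHAPE OF (7.1.11)**, PROVED for every translation-invariant cross-lattice operator: *"(Q^e_k f)~(p′) = Σ_l [symbol](p′+l)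
f̃(p′+l)"* — `(Tf)^_i(p′) = c·Σ_l Σ_j σ_T(p′+l)_{ij} f̂_j(p′+l)`, the `Σ_l` running over the `n^d` offsets `k` of the coset of
`q ↔ p′` (`c = (√(n^d))^{−1}`, the ratio of the two unitary DFT normalisations). [cite: BalabanImbrieJaffe1985, (7.1.11) p.322] -/
theorem dftC_mulVec_cross {T : Matrix (Tor M × m) (Tor (fine n M) × m') ℂ} (hT : IsCrossTI n M m m' T)
    (f : Tor (fine n M) × m' → ℂ) (q : Tor M) (i : m) :
    (dftC M m *ᵥ (T *ᵥ f)) (q, i)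
      = (cQ n M : ℂ) * ∑ k : Fin d → Fin n, ∑ j : m',
          symbX n M m m' T (pOf n M (k, q)) i j * (dftC (fine n M) m' *ᵥ f) (pOf n M (k, q), j) := by
  have h : dftC M m *ᵥ (T *ᵥ f)
      = (dftC M m * T * star (dftC (fine n M) m')) *ᵥ (dftC (fine n M) m' *ᵥ f) := by
    rw [Matrix.mulVec_mulVec, Matrix.mulVec_mulVec, Matrix.mul_assoc (dftC M m * T), star_dftC_mul, Matrix.mul_one]
  rw [h, Matrix.mulVec, dotProduct, Fintype.sum_prod_type,
    ← (pOf_bijective n M).sum_comp (fun p => ∑ j : m',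
      (dftC M m * T * star (dftC (fine n M) m')) (q, i) (p, j) * (dftC (fine n M) m' *ᵥ f) (p, j)),
    Fintype.sum_prod_type, Finset.mul_sum]
  refine Finset.sum_congr rfl fun k _ => ?_
  rw [Finset.sum_eq_single q]
  · rw [Finset.mul_sum]
    refine Finset.sum_congr rfl fun j _ => ?_
    rw [dftC_mul_mul_star_apply n M m m' hT, if_pos rfl, mul_assoc]
  · intro q' _ hq'
    refine Finset.sum_eq_zero fun j _ => ?_
    rw [dftC_mul_mul_star_apply n M m m' hT, if_neg (Ne.symm hq'), zero_mul]
  · exact fun h => absurd (Finset.mem_univ q) h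

/-! ## §4 The class is closed under the algebra of (7.1.12) -/

variable {n M m m' m''}

omit [NeZero n] hM [Fintype m] [DecidableEq m] [Fintype m'] [DecidableEq m'] in
/-- sums of translation-invariant cross-lattice operators are translation invariant. [cite: BalabanImbrieJaffe1985, (7.1.12) p.322] -/
theorem IsCrossTI.add {T S : Matrix (Tor M × m) (Tor (fine n M) × m') ℂ} (hT : IsCrossTI n M m m' T)
    (hS : IsCrossTI n M m m' S) : IsCrossTI n M m m' (T + S) := fun a y x i j => by
  rw [Matrix.add_apply, Matrix.add_apply, hT, hS]

omit [NeZero n] hM [Fintype m] [DecidableEq m] [Fintype m'] [DecidableEq m'] in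
/-- scalar multiples (normalisations `η^{d−2}`, `L^{−(d−2)}` of (2.21)) are translation invariant.
[cite: BalabanImbrieJaffe1985, (7.1.12) p.322] -/
theorem IsCrossTI.smul {T : Matrix (Tor M × m) (Tor (fine n M) × m') ℂ} (hT : IsCrossTI n M m m' T) (c : ℂ) :
    IsCrossTI n M m m' (c • T) := fun a y x i j => by
  rw [Matrix.smul_apply, Matrix.smul_apply, hT]

omit [NeZero n] [Fintype m] [DecidableEq m] [DecidableEq m'] [Fintype m''] [DecidableEq m''] in
/-- unit-TI ∘ cross: `B T` is translation invariant for a translation-invariant unit-lattice operator `B`.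
[cite: BalabanImbrieJaffe1985, (7.1.12) p.322] -/
theorem IsCrossTI.mul_left {B : Matrix (Tor M × m) (Tor M × m') ℂ} {T : Matrix (Tor M × m') (Tor (fine n M) × m'') ℂ}
    (hB : IsTranslInvR M m m' B) (hT : IsCrossTI n M m' m'' T) : IsCrossTI n M m m'' (B * T) := by
  intro a y x i j
  rw [Matrix.mul_apply, Matrix.mul_apply, Fintype.sum_prod_type, Fintype.sum_prod_type]
  symm
  refine Fintype.sum_equiv (Equiv.addRight a) _ _ fun w => ?_
  show ∑ l, B (y, i) (w, l) * T (w, l) (x, j) = ∑ l, B (y + a, i) (w + a, l) * T (w + a, l) (x + up n M a, j)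
  simp only [hB a y w, hT a w x]

omit [Fintype m] [DecidableEq m] [DecidableEq m'] [Fintype m''] [DecidableEq m''] in
/-- cross ∘ fine-TI: `T A` is translation invariant for a translation-invariant η-lattice operator `A` (the `∂`, `∂^*`, `I` of
(7.1.12)). [cite: BalabanImbrieJaffe1985, (7.1.12) p.322] -/
theorem IsCrossTI.mul_right {T : Matrix (Tor M × m) (Tor (fine n M) × m') ℂ}
    {A : Matrix (Tor (fine n M) × m') (Tor (fine n M) × m'') ℂ} (hT : IsCrossTI n M m m' T)
    (hA : IsTranslInvR (fine n M) m' m'' A) : IsCrossTI n M m m'' (T * A) := by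
  intro a y x i j
  rw [Matrix.mul_apply, Matrix.mul_apply, Fintype.sum_prod_type, Fintype.sum_prod_type]
  symm
  refine Fintype.sum_equiv (Equiv.addRight (up n M a)) _ _ fun w => ?_
  show ∑ l, T (y, i) (w, l) * A (w, l) (x, j) = ∑ l, T (y + a, i) (w + up n M a, l) * A (w + up n M a, l) (x + up n M a, j)
  simp only [hT a y w, hA (up n M a) w x]

omit [Fintype m] [DecidableEq m] [DecidableEq m'] [Fintype m''] [DecidableEq m''] in
/-- cross ∘ cross^*: `T S^*` is a translation-invariant UNIT-lattice operator (`Q^e_k […] Q^{e*}_k` of (7.1.12)).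
[cite: BalabanImbrieJaffe1985, (7.1.12) p.322] -/
theorem IsCrossTI.mul_conjTranspose {T : Matrix (Tor M × m) (Tor (fine n M) × m') ℂ}
    {S : Matrix (Tor M × m'') (Tor (fine n M) × m') ℂ} (hT : IsCrossTI n M m m' T) (hS : IsCrossTI n M m'' m' S) :
    IsTranslInvR M m m'' (T * Sᴴ) := by
  intro a y y' i j
  rw [Matrix.mul_apply, Matrix.mul_apply, Fintype.sum_prod_type, Fintype.sum_prod_type]
  symm
  refine Fintype.sum_equiv (Equiv.addRight (up n M a)) _ _ fun w => ?_
  show ∑ l, T (y, i) (w, l) * Sᴴ (w, l) (y', j) = ∑ l, T (y + a, i) (w + up n M a, l) * Sᴴ (w + up n M a, l) (y' + a, j)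
  simp only [Matrix.conjTranspose_apply, hT a y w, hS a y' w]

/-! ## §5 Fibre algebra: how cross fibre operators compose -/

variable (n M m m' m'')

omit [Fintype m] [DecidableEq m] [DecidableEq m'] [Fintype m''] [DecidableEq m''] in
/-- unit fibre ∘ cross fibre: `(⊕_{p′} B(p′)) crossFibre S = crossFibre (p ↦ B(p mod 2π) S(p))`.
[cite: BalabanImbrieJaffe1985, (7.1.12) p.322] -/
theorem fibreOpR_mul_crossFibre (B : Tor M → Matrix m m' ℂ) (S : Tor (fine n M) → Matrix m' m'' ℂ) :
    fibreOpR M m m' B * crossFibre n M m' m'' S = crossFibre n M m m'' (fun p => B (coarse n M p) * S p) := by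
  ext ⟨q, i⟩ ⟨p, j⟩
  rw [Matrix.mul_apply, Fintype.sum_prod_type, Finset.sum_eq_single q]
  · rw [crossFibre_apply]
    split_ifs with h
    · rw [Matrix.mul_apply, ← h]
      refine Finset.sum_congr rfl fun l _ => ?_
      rw [fibreOpR_apply, crossFibre_apply, if_pos rfl, if_pos h]
    · refine Finset.sum_eq_zero fun l _ => ?_
      rw [crossFibre_apply, if_neg h, mul_zero]
  · intro q₁ _ hq₁
    refine Finset.sum_eq_zero fun l _ => ?_
    rw [fibreOpR_apply, if_neg (Ne.symm hq₁), zero_mul]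
  · exact fun h => absurd (Finset.mem_univ q) h

omit [Fintype m] [DecidableEq m] [DecidableEq m'] [Fintype m''] [DecidableEq m''] in
/-- cross fibre ∘ fine fibre: `crossFibre S (⊕_p C(p)) = crossFibre (p ↦ S(p) C(p))`. [cite: BalabanImbrieJaffe1985, (7.1.12) p.322] -/
theorem crossFibre_mul_fibreOpR (S : Tor (fine n M) → Matrix m m' ℂ) (C : Tor (fine n M) → Matrix m' m'' ℂ) :
    crossFibre n M m m' S * fibreOpR (fine n M) m' m'' C = crossFibre n M m m'' (fun p => S p * C p) := by
  ext ⟨q, i⟩ ⟨p, j⟩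
  rw [Matrix.mul_apply, Fintype.sum_prod_type, Finset.sum_eq_single p]
  · rw [crossFibre_apply]
    split_ifs with h
    · rw [Matrix.mul_apply]
      refine Finset.sum_congr rfl fun l _ => ?_
      rw [fibreOpR_apply, crossFibre_apply, if_pos rfl, if_pos h]
    · refine Finset.sum_eq_zero fun l _ => ?_
      rw [crossFibre_apply, if_neg h, zero_mul]
  · intro p₁ _ hp₁
    refine Finset.sum_eq_zero fun l _ => ?_
    rw [fibreOpR_apply, if_neg hp₁, mul_zero]
  · exact fun h => absurd (Finset.mem_univ p) h

omit [Fintype m] [DecidableEq m] [DecidableEq m'] [Fintype m''] [DecidableEq m''] in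
/-- cross fibre ∘ (cross fibre)^*: a unit-lattice fibre operator whose fibre at `p′` SUMS OVER THE COSET,
`Σ_l S(p′+l) S′(p′+l)^*` (the mechanism behind the `Σ_l` of (7.1.14)–(7.1.16)). [cite: BalabanImbrieJaffe1985, (7.1.14) p.322] -/
theorem crossFibre_mul_conjTranspose (S : Tor (fine n M) → Matrix m m' ℂ) (S' : Tor (fine n M) → Matrix m'' m' ℂ) :
    crossFibre n M m m' S * (crossFibre n M m'' m' S')ᴴ
      = fibreOpR M m m'' (fun q => ∑ k : Fin d → Fin n, S (pOf n M (k, q)) * (S' (pOf n M (k, q)))ᴴ) := by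
  ext ⟨q, i⟩ ⟨q₂, i₂⟩
  rw [Matrix.mul_apply, Fintype.sum_prod_type,
    ← (pOf_bijective n M).sum_comp (fun p => ∑ l : m',
      crossFibre n M m m' S (q, i) (p, l) * (crossFibre n M m'' m' S')ᴴ (p, l) (q₂, i₂)),
    Fintype.sum_prod_type, fibreOpR_apply]
  by_cases hq : q = q₂
  · subst hq
    rw [if_pos rfl, Matrix.sum_apply]
    refine Finset.sum_congr rfl fun k _ => ?_
    rw [Finset.sum_eq_single q]
    · rw [Matrix.mul_apply]
      refine Finset.sum_congr rfl fun l _ => ?_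
      rw [Matrix.conjTranspose_apply, crossFibre_apply_pOf, crossFibre_apply_pOf, if_pos rfl, if_pos rfl,
        Matrix.conjTranspose_apply]
    · intro q' _ hq'
      refine Finset.sum_eq_zero fun l _ => ?_
      rw [crossFibre_apply_pOf, if_neg (Ne.symm hq'), zero_mul]
    · exact fun h => absurd (Finset.mem_univ q) h
  · rw [if_neg hq]
    refine Finset.sum_eq_zero fun k _ => Finset.sum_eq_zero fun q' _ => Finset.sum_eq_zero fun l _ => ?_
    rw [Matrix.conjTranspose_apply, crossFibre_apply_pOf, crossFibre_apply_pOf]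
    by_cases h1 : q = q'
    · subst h1
      rw [if_neg (Ne.symm hq), star_zero, mul_zero]
    · rw [if_neg h1, zero_mul]

/-! ## §6 The symbol rules -/

/-- kernel: `c = (√(n^d))^{−1} ≠ 0`. [folklore] -/
private theorem cQ_ne_zero : (cQ n M : ℂ) ≠ 0 := by
  have hn : (0 : ℝ) < (n : ℝ) ^ d := pow_pos (by exact_mod_cast Nat.pos_of_ne_zero (NeZero.ne n)) d
  rw [cQ_eq]
  exact_mod_cast (inv_pos.mpr (Real.sqrt_pos.mpr hn)).ne'

/-- **`σ_{BT}(p′+l) = σ_B(p′) σ_T(p′+l)`** for a translation-invariant unit-lattice `B` (rectangular symbol `symbR` of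
`BIJ85Eq712SymbolCalculus`) and a translation-invariant cross-lattice `T`. [cite: BalabanImbrieJaffe1985, (7.1.12) p.322] -/
theorem symbX_mul_left {B : Matrix (Tor M × m) (Tor M × m') ℂ} {T : Matrix (Tor M × m') (Tor (fine n M) × m'') ℂ}
    (hB : IsTranslInvR M m m' B) (hT : IsCrossTI n M m' m'' T) (p : Tor (fine n M)) :
    symbX n M m m'' (B * T) p = symbR M m m' B (coarse n M p) * symbX n M m' m'' T p := by
  have h1 := dftC_mul_mul_star_cross n M m m'' (IsCrossTI.mul_left hB hT)
  have h2 : dftC M m * (B * T) * star (dftC (fine n M) m'')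
      = crossFibre n M m m'' (fun p => symbR M m m' B (coarse n M p) * ((cQ n M : ℂ) • symbX n M m' m'' T p)) := by
    rw [← fibreOpR_mul_crossFibre, ← dftC_mul_mul_star M m m' hB, ← dftC_mul_mul_star_cross n M m' m'' hT]
    calc dftC M m * (B * T) * star (dftC (fine n M) m'')
        = dftC M m * B * (star (dftC M m') * dftC M m') * T * star (dftC (fine n M) m'') := by
          rw [star_dftC_mul, Matrix.mul_one, Matrix.mul_assoc (dftC M m) B T]
      _ = dftC M m * B * star (dftC M m') * (dftC M m' * T * star (dftC (fine n M) m'')) := by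
          simp only [Matrix.mul_assoc]
  have h3 := congrFun (crossFibre_inj n M m m'' (h1.symm.trans h2)) p
  simp only [Matrix.mul_smul] at h3
  exact smul_right_injective _ (cQ_ne_zero n M) h3

/-- **`σ_{TA}(p) = σ_T(p) σ_A(p)`** for a translation-invariant cross-lattice `T` and a translation-invariant η-lattice
operator `A` (symbol `symbR` on the η-torus). [cite: BalabanImbrieJaffe1985, (7.1.12) p.322] -/
theorem symbX_mul_right {T : Matrix (Tor M × m) (Tor (fine n M) × m') ℂ}
    {A : Matrix (Tor (fine n M) × m') (Tor (fine n M) × m'') ℂ} (hT : IsCrossTI n M m m' T)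
    (hA : IsTranslInvR (fine n M) m' m'' A) (p : Tor (fine n M)) :
    symbX n M m m'' (T * A) p = symbX n M m m' T p * symbR (fine n M) m' m'' A p := by
  have h1 := dftC_mul_mul_star_cross n M m m'' (IsCrossTI.mul_right hT hA)
  have h2 : dftC M m * (T * A) * star (dftC (fine n M) m'')
      = crossFibre n M m m'' (fun p => ((cQ n M : ℂ) • symbX n M m m' T p) * symbR (fine n M) m' m'' A p) := by
    rw [← crossFibre_mul_fibreOpR, ← dftC_mul_mul_star (fine n M) m' m'' hA, ← dftC_mul_mul_star_cross n M m m' hT]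
    calc dftC M m * (T * A) * star (dftC (fine n M) m'')
        = dftC M m * T * (star (dftC (fine n M) m') * dftC (fine n M) m') * A * star (dftC (fine n M) m'') := by
          rw [star_dftC_mul, Matrix.mul_one, Matrix.mul_assoc (dftC M m) T A]
      _ = dftC M m * T * star (dftC (fine n M) m') * (dftC (fine n M) m' * A * star (dftC (fine n M) m'')) := by
          simp only [Matrix.mul_assoc]
  have h3 := congrFun (crossFibre_inj n M m m'' (h1.symm.trans h2)) p
  simp only [Matrix.smul_mul] at h3
  exact smul_right_injective _ (cQ_ne_zero n M) h3

/-- **`σ_{TS^*}(p′) = c²·Σ_l σ_T(p′+l) σ_S(p′+l)^*`**: the unit-lattice operator `T S^*` sums its symbol OVER THE COSET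
(`c² = n^{−d}`; with the paper's weighted adjoint `Q^{e*}_k = η^{−d}·(Q^e_k)ᴴ` of (2.22) the constant is `1`).
[cite: BalabanImbrieJaffe1985, (7.1.14) p.322] -/
theorem symb_mul_conjTranspose {T : Matrix (Tor M × m) (Tor (fine n M) × m') ℂ}
    {S : Matrix (Tor M × m'') (Tor (fine n M) × m') ℂ} (hT : IsCrossTI n M m m' T) (hS : IsCrossTI n M m'' m' S)
    (q : Tor M) :
    symbR M m m'' (T * Sᴴ) q
      = ((cQ n M : ℂ) ^ 2) • ∑ k : Fin d → Fin n, symbX n M m m' T (pOf n M (k, q)) * (symbX n M m'' m' S (pOf n M (k, q)))ᴴ := by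
  have h1 := dftC_mul_mul_star M m m'' (IsCrossTI.mul_conjTranspose hT hS)
  have hSt : dftC (fine n M) m' * Sᴴ * star (dftC M m'') = (dftC M m'' * S * star (dftC (fine n M) m'))ᴴ := by
    rw [Matrix.star_eq_conjTranspose, Matrix.star_eq_conjTranspose, Matrix.conjTranspose_mul,
      Matrix.conjTranspose_mul, Matrix.conjTranspose_conjTranspose, Matrix.mul_assoc]
  have h2 : dftC M m * (T * Sᴴ) * star (dftC M m'')
      = crossFibre n M m m' (fun p => (cQ n M : ℂ) • symbX n M m m' T p)
          * (crossFibre n M m'' m' (fun p => (cQ n M : ℂ) • symbX n M m'' m' S p))ᴴ := by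
    rw [← dftC_mul_mul_star_cross n M m m' hT, ← dftC_mul_mul_star_cross n M m'' m' hS, ← hSt]
    calc dftC M m * (T * Sᴴ) * star (dftC M m'')
        = dftC M m * T * (star (dftC (fine n M) m') * dftC (fine n M) m') * Sᴴ * star (dftC M m'') := by
          rw [star_dftC_mul, Matrix.mul_one, Matrix.mul_assoc (dftC M m) T Sᴴ]
      _ = dftC M m * T * star (dftC (fine n M) m') * (dftC (fine n M) m' * Sᴴ * star (dftC M m'')) := by
          simp only [Matrix.mul_assoc]
  rw [crossFibre_mul_conjTranspose] at h2
  have h3 := congrFun (fibreOpR_inj M m m'' (h1.symm.trans h2)) q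
  beta_reduce at h3
  rw [h3, Finset.smul_sum]
  refine Finset.sum_congr rfl fun k _ => ?_
  rw [Matrix.conjTranspose_smul, Matrix.smul_mul, Matrix.mul_smul, smul_smul, sq]
  congr 1
  rw [Complex.star_def, Complex.conj_ofReal]

/-- **THE SANDWICH** *"σ_k has the general form of … projection operators, sandwiched between averaging operators"* (p. 323),
*"each term on the right side is evaluated at momentum p′ + l"* (7.1.14): for translation-invariant cross-lattice `T`, `S` and
a translation-invariant η-lattice operator `R`, `σ_{T R S^*}(p′) = c²·Σ_l σ_T(p′+l) σ_R(p′+l) σ_S(p′+l)^*`.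
[cite: BalabanImbrieJaffe1985, (7.1.14) p.322] -/
theorem symb_sandwich {T : Matrix (Tor M × m) (Tor (fine n M) × m') ℂ}
    {R : Matrix (Tor (fine n M) × m') (Tor (fine n M) × m') ℂ} {S : Matrix (Tor M × m'') (Tor (fine n M) × m') ℂ}
    (hT : IsCrossTI n M m m' T) (hR : IsTranslInvR (fine n M) m' m' R) (hS : IsCrossTI n M m'' m' S) (q : Tor M) :
    symbR M m m'' (T * R * Sᴴ) q
      = ((cQ n M : ℂ) ^ 2) • ∑ k : Fin d → Fin n, symbX n M m m' T (pOf n M (k, q))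
          * symbR (fine n M) m' m' R (pOf n M (k, q)) * (symbX n M m'' m' S (pOf n M (k, q)))ᴴ := by
  rw [symb_mul_conjTranspose n M m m' m'' (IsCrossTI.mul_right hT hR) hS q]
  congr 1
  refine Finset.sum_congr rfl fun k _ => ?_
  rw [symbX_mul_right n M m m' m' hT hR]

/-- `c² = n^{−d} = η^d`: the constant of the coset sums. [cite: BalabanImbrieJaffe1985, (7.1.11) p.322] -/
theorem cQ_sq : (cQ n M : ℂ) ^ 2 = (((n : ℂ) ^ d))⁻¹ := by
  have hn : (0 : ℝ) ≤ (n : ℝ) ^ d := pow_nonneg (Nat.cast_nonneg n) d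
  rw [cQ_eq]
  push_cast
  rw [inv_pow, ← Complex.ofReal_pow, Real.sq_sqrt hn]
  push_cast
  rfl

end

end Literature.MathematicalPhysics.QuantumFieldTheory.BalabanImbrieJaffe1984to88.BIJ85Eq7111CrossSymbols
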